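import Summits.SmoothPoincare4.SmoothPoincare4.Theses.CylinderEntropy
import Summits.SmoothPoincare4.SmoothPoincare4.Theses.NoOneHandles
import Summits.SmoothPoincare4.SmoothPoincare4.Theses.EntropyLadder
import Summits.SmoothPoincare4.SmoothPoincare4.Theorems.CylinderEntropyThinCrossSectionExistsOfMassSlackUnconditional

/-!
# Strategy census r1 (second opinion) — companion file for crux `CylinderEntropy.ThinCrossSectionExists` (E)

Strategist `cstrat-stmt-SmoothPoincare4-7633-r1` (redirect, different technique inventory: handlebody /
Kirby calculus, entropy–handle-index dictionary, 5-dimensional Schoenflies, families).  This file records,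
kernel-checked and sorry-free, the two typed DECOMPOSITIONS of E that the inventory produces and shows what
is wrong with them as decompositions *of E inside this route*: both assemblies are proved — but each proof
FACTORS THROUGH THE SUMMIT `SmoothPoincare4` itself (⋀ pieces → S → E, the last arrow being the landed
unconditional half `BallMassSlack.crux_of_smoothPoincare4`, p100422), and the pieces are verbatim the crux
sets of the sibling routes `NoOneHandles` (items stmt-SmoothPoincare4-0378/0377) and `EntropyLadder`
(items 3719/3718/3717).  A split of E whose glue passes through S discards this route's own cone
(X₁ `CylinderSurgeryResolution`, X₂ `NearSliceRecognition`, G) and re-files a sibling route under this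
route's id — D-0019: an alternative decomposition of S is a separate route (both already exist), never a
family inside this one.  See `STRATEGY-CENSUS-r1.md` §Decomposition.

The summit-strength certificate that (3) of the redirect instruction asks for is
`Theorems/CylinderEntropyThinCrossSectionExistsIffSummit.lean`
(`thinCrossSectionExists_and_cylinderRungTwo_iff_smoothPoincare4 : (E ∧ R) ↔ S`,
`thinCrossSectionExists_iff_smoothPoincare4 : R → (E ↔ S)`), re-landed closes-free by this seat (p172162)
after rev-10 `closes` grew to four binders, together with s1's
`Cruxes/ThinCrossSectionExists/StrategyCensusS1.lean` (`crux_iff_smoothPoincare4_of_cone : X₁ → X₂ → (E ↔ S)`).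
-/

-- the registered namespace `Summit.SmoothPoincare4.SmoothPoincare4.…` repeats a component
set_option linter.dupNamespace false

namespace Summit.SmoothPoincare4.SmoothPoincare4.Cruxes.ThinCrossSectionExists.StrategyCensusR1

open Summit.SmoothPoincare4.SmoothPoincare4

/-- **J-split (handlebody inventory).**  E ⇐ J₁ ∧ J₂ with
J₁ = `NoOneHandles.NoohNoOneHandles` (every homotopy 4-sphere has a Morse function without index-1 critical
points; Kirby Problem 4.18 restricted to homotopy spheres, item stmt-SmoothPoincare4-0378, no skeleton, no line) and
J₂ = `NoOneHandles.NoohGscStandard` (geometrically simply connected homotopy 4-spheres are standard ⟺ the weak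
Generalised Property R conjecture, Gompf–Scharlemann–Thompson 2010 Prop. 9.2; item stmt-SmoothPoincare4-0377).
The assembly is PROVED — by going through the summit: `NoOneHandles.closes` then `crux_of_smoothPoincare4`. -/
theorem crux_of_noOneHandles_split
    (h₁ : Theses.NoOneHandles.NoohNoOneHandles) (h₂ : Theses.NoOneHandles.NoohGscStandard) :
    Theses.CylinderEntropy.ThinCrossSectionExists :=
  Theorems.ThinCrossSectionExists.BallMassSlack.crux_of_smoothPoincare4
    (Theses.NoOneHandles.closes h₁ h₂)

/-- The J-split's glue literally is "S → E" after "J₁ → J₂ → S": the summit is an intermediate node. -/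
theorem noOneHandles_split_factors_through_summit
    (h₁ : Theses.NoOneHandles.NoohNoOneHandles) (h₂ : Theses.NoOneHandles.NoohGscStandard) :
    _root_.SmoothPoincare4 :=
  Theses.NoOneHandles.closes h₁ h₂

/-- **K-split (entropy–handle-index inventory).**  E ⇐ K₁ ∧ K₂ ∧ K₃ with the Euclidean Gaussian-entropy
rung one level up: K₁ = `EntropyLadder.ThinEmbeddingExists` (λ < λ(S¹×ℝ³) embedding exists ⟺ every homotopy
4-sphere bounds a contractible 5-dimensional 2-handlebody; item 3719), K₂ = `EntropyLadder.ThinSpheresBoundTwoHandlebodies`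
(item 3718), K₃ = `EntropyLadder.PresentationSpheresStandard` (presentation spheres ∂H⁵(P, ε) are standard = the
5-dimensional Andrews–Curtis problem; item 3717).  Again the assembly is PROVED through the summit. -/
theorem crux_of_entropyLadder_split
    (hE : Theses.EntropyLadder.ThinEmbeddingExists) (hG : Theses.EntropyLadder.ThinSpheresBoundTwoHandlebodies)
    (hT : Theses.EntropyLadder.PresentationSpheresStandard) :
    Theses.CylinderEntropy.ThinCrossSectionExists :=
  Theorems.ThinCrossSectionExists.BallMassSlack.crux_of_smoothPoincare4
    (Theses.EntropyLadder.closes hE hG hT)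

/-- The K-split's glue also has the summit as an intermediate node. -/
theorem entropyLadder_split_factors_through_summit
    (hE : Theses.EntropyLadder.ThinEmbeddingExists) (hG : Theses.EntropyLadder.ThinSpheresBoundTwoHandlebodies)
    (hT : Theses.EntropyLadder.PresentationSpheresStandard) :
    _root_.SmoothPoincare4 :=
  Theses.EntropyLadder.closes hE hG hT

/-- **Why every split produced looks like this (pointwise form).**  E is a `∀ M` statement whose instance at a
manifold already known to be standard is a theorem (`crux_of_smoothPoincare4` specialised); so any family of
pieces proving E must, at a hypothetical exotic `M`, either standardise `M` (then it proves the summit at `M`,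
as above) or produce a thin cross-section of an exotic `M` — which the route's own recognition crux R
(`CylinderRungTwo`, = G X₁ X₂ with G closed) forbids.  Recorded here as the pointwise sandwich, both halves
by name: S → E unconditionally, E → S given R. -/
theorem sandwich :
    (_root_.SmoothPoincare4 → Theses.CylinderEntropy.ThinCrossSectionExists) ∧
    (Theses.CylinderEntropy.CylinderRungTwo →
      Theses.CylinderEntropy.ThinCrossSectionExists → _root_.SmoothPoincare4) := by
  refine ⟨Theorems.ThinCrossSectionExists.BallMassSlack.crux_of_smoothPoincare4, fun hR hE => ?_⟩
  unfold _root_.SmoothPoincare4 Literature.SPC4.SmoothPoincareConjectureFour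
    ContinuousMap.HomotopyEquiv.NonemptyDiffeomorphSphere
  intro M _ _ _ _ _ e
  obtain ⟨ι, hι, hN', hsep, hlt⟩ := hE M e
  exact hR M e ι hι hN' hsep hlt

/-- The route's cone makes E summit-EQUIVALENT: with the closed glue item G (`RungTwoOfSurgeryResolution`,
proved in `Theorems/…` @94eb4949f6a2 and taken here as a hypothesis to keep this file import-light) and the two
open cylinder cruxes X₁, X₂, E ↔ S.  (Same content as s1's `crux_iff_smoothPoincare4_of_cone`; restated so the
r1 census is self-contained.) -/
theorem crux_iff_summit_of_cone
    (hX : Theses.CylinderEntropy.CylinderSurgeryResolution) (hN : Theses.CylinderEntropy.NearSliceRecognition)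
    (hG : Theses.CylinderEntropy.RungTwoOfSurgeryResolution) :
    (Theses.CylinderEntropy.ThinCrossSectionExists ↔ _root_.SmoothPoincare4) :=
  ⟨fun hE => sandwich.2 (hG hX hN) hE, sandwich.1⟩

end Summit.SmoothPoincare4.SmoothPoincare4.Cruxes.ThinCrossSectionExists.StrategyCensusR1
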